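import Summits.QuantumFields.BalabanUV.Beta.GAN24.SrecLinearPartEq
import Summits.QuantumFields.BalabanUV.Beta.GAN24.RespStepSemigroup
import Summits.QuantumFields.BalabanUV.Beta.AxialDressingRootedBmLinear
import Summits.QuantumFields.BalabanUV.Beta.CoDressedMmRead

/-!
# `BalabanUV.Beta.GAN24.RespStepBm` — binder row G-an2-4 / (CONV-C), S-slot road «SREC» (row owner gan24-p1-g12's `SKELETON-SREC.md` v0.2 SR-L1 ∕
# PART V row V1-d; RULINGS-15 (R15-4) «SREC-RESPBM»): THE Π_bm-DRESSED LEG FAMILIES — the four legs of the CO-DRESSED kernel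
# `coDressKBmAt ρ N K = Πᵀ_bm ∘ K ∘ Π_bm`, their localisation, the dressed one-step response families `respStepBm` of the literal in the adopted units,
# and the DRESSED-LEG READ IDENTITY for `e3K (coDressKBmAt ρ N K) N S`

NOT IN PRINT; OUR BOOKKEEPING (G-an2-4 formalisation swarm, leaf prover `b2b-balaban-gan24-formalise-leaf-01`, gen 43; the row owner's RULINGS-15 (R15-4)
invitation, journal `CLAIMS.log` l.17352, claim l.17885; names PROVISIONAL — the owner may rename / re-cut).  HONEST FRAMING (cell contract, verbatim):
«discharging `BetaPertH` makes Bałaban's UV stability UNCONDITIONAL — a real constructive-QFT result; it is NOT the continuum limit and NOT the Clay problem.»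
HONEST DEPENDENCY (verbatim): «continuum YM on T⁴ ⇐ BetaPertH ∧ nine spine estimates (0/9 proved); BetaPertH ⇐ (D1) ∧ (D4) ∧ CAP+tail; G-an2-4 gates
asym, D1 and NE2/3/4.»

WHAT.  The cubic line of an2's `SrecAt` recursion reads the CO-DRESSED step resolvent `Ĝ_j := coDressKBmAt ρ Lc (KInvStep Lc j)` (in units
`coDressKBmAt ρ Lc K̃_j`, `K̃_j = KStepUnit Lc j`, asym1's `unitK_coDressKBmAt`).  By leaf-01's four-channel read identity
(`SrecLinearPartEq.e3K_eq_neg_sum_push₃`) the linear map `S ↦ e3K Ĝ N S` is a sum of four three-leg pushes through the leg families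
`rowM Ĝ N`, `rowMM Ĝ N`, `colH Ĝ N`, `colM Ĝ N` — so SR-L1 needs these four legs of the co-dressed kernel in terms of the legs of `K`:
* §1 `bmW ρ N r μ y κ u := coProjBmW ρ N (r μ y) κ u` — an2's window operator `coProjBmW` (`AxialDressingRootedBmLinear`) acting on the FINE bond of a
  leg family; `bmW_neg`; **`legDecay_bmW`**: `LegDecay r M C m`, `0 ≤ m`, in-block root `ρ = toSite rr`, `1 ≤ N` ⟹
  `LegDecay (bmW ρ N r) M (cKb d N m · C) m` (SAME rate; an2's `abs_pmBm_le` and the window diameter `l1_le_of_mem_cube`; `cKb d N m = cWb d N · e^{m(d+1)N}`).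
* §2 THE FOUR LEGS OF THE CO-DRESSED KERNEL: `colH (coDressKBmAt ρ N K) N = bmW ρ N (colH K N)` (an2's `colH_coDressKBmAt_eq`, restated),
  **`rowM_coDressKBmAt`**: `rowM (coDressKBmAt ρ N K) N = bmW ρ N (rowM K N)` (NEW twin: `comp_trK_piKBm_inr` + `sum_piKBm_col_inl` + `tsum_window′`),
  `colM_coDressKBmAt` ∕ `rowMM_coDressKBmAt`: the multiplier-slot legs are UNDRESSED (`coDressKBmAt_inr_inr`); `LegDecay` of all four from `Decays K`.
* §3 THE LITERAL'S DRESSED RESPONSE FAMILIES IN UNITS: `respStepBm ρ Lc M N′ := bmW ρ Lc (respStep M N′)` (an2's (K1b′) response family through the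
  window); **`colH_coDressKBmAt_KStepUnit`**: `colH (coDressKBmAt ρ Lc K̃_j) Lc = respStepBm ρ Lc (Lc^j) (Lc^(j+1))`, **`rowM_coDressKBmAt_KStepUnit`**:
  `rowM (coDressKBmAt ρ Lc K̃_j) Lc = −respStepBm ρ Lc (Lc^j) (Lc^(j+1))` (leaf-12's `colH_KStepUnit` ∕ `rowM_KStepUnit_eq`: `ℋ♭ = −ℋᵀ`); their
  `LegDecay` from `Decays K̃_j` — the iterates are `legComp`-chains (`Push4Iter.legChain`; NO semigroup is claimed for the dressed families), and the
  levelwise hypotheses of leaf-01's `Push3Nest.transport_push₃` are met (`legDecay_respStepBm_of_decays`).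
* §4 **THE DRESSED-LEG READ IDENTITY** `e3K_coDressKBmAt_eq_neg_sum_push₃`: decaying `K`, local `S`, in-block root, `1 ≤ N` ⟹
  `e3K (coDressKBmAt ρ N K) N S κ′ u′ = −(push₃ (bmW ρ N (rowM K N)) (bmW ρ N (colH K N)) (bmW ρ N (colH K N)) (reslot inl inl S) + push₃ (bmW ρ N (rowM K N))
  (colM K N) (bmW ρ N (colH K N)) (reslot inl inr S) + push₃ (rowMM K N) (bmW ρ N (colH K N)) (bmW ρ N (colH K N)) (reslot inr inl S) + push₃ (rowMM K N) (colM K N)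
  (bmW ρ N (colH K N)) (reslot inr inr S)) κ′ u′`, and its `K̃_j` instance `e3K_coDressKBmAt_KStepUnit` with the legs `∓respStepBm` ∕ `rowMM K̃_j` ∕ `colM K̃_j`.
[folklore] throughout: two plumbing `def`s (`bmW`, `respStepBm`), finite-sum bookkeeping over an2's `AxialDressingRootedBm*` ∕ `CoDressedMmRead`, leaf-12's
`RespStepSemigroup`, leaf-01's `Push3` ∕ `SrecLinearPartEq` BY NAME; 0 cited facts, 0 `def … : Prop`, 0 sorry.  NO estimate (the dressed families' uniform
decay with gradient gain — SR-L4b `RespStepBmDecay` — is the owner's reserved ESTIMATE row and is NOT touched); asserts NO shape of Bałaban's stencils;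
discharges NOTHING of (hS, hSall) on (E); 0 wall binders; NEVER «G-an2-4 closed»; NOT D1, NOT BetaPertH, NOT continuum, NOT Clay.
-/

noncomputable section

open Finset
open scoped BigOperators
open Literature.MathematicalPhysics.QuantumFieldTheory
open Literature.MathematicalPhysics.QuantumFieldTheory.Balaban1983to89
open Literature.MathematicalPhysics.QuantumFieldTheory.Balaban1983to89.Beta
open B12Sec2to5 (l1 l1_nonneg)
open ExpKernelCalculus (MKer Decays BiLoc comp Zl Zl_nonneg l1_sub_symm l1_sub_triangle)
open AffineAveraging (Form1 box toSite)
open OneStepResolventKernel (Fib wsum LocStencil)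
open OneStepKernelFamily (colH vertexOfK)
open BalabanCompositeJets (respStep)
open Summit.QuantumFields.BalabanUV.Beta.TameKernelCalculus (trK)
open Summit.QuantumFields.BalabanUV.Beta.AxialDressingRooted (cube pmBm piKBm coProjBmW coProjBmW_apply coDressKBmAt coDressKBmAt_eq
  colH_coDressKBmAt_eq coDressKBmAt_inr_inr comp_trK_piKBm_inr sum_piKBm_col_inl tsum_window' abs_pmBm_le l1_le_of_mem_cube card_cube cWb cKb
  cKb_nonneg decays_coDressKBmAt)
open Summit.QuantumFields.BalabanUV.Beta.GAN24.CombesThomas (KStepUnit)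
open Summit.QuantumFields.BalabanUV.Beta.GAN24.Push4 (rowM rowM_apply colH_apply' legComp vertexW Lk Rk ffRead IsFF)
open Summit.QuantumFields.BalabanUV.Beta.GAN24.Push4Bounds (LegDecay LegDecay.nonneg legDecay_colH legDecay_rowM)
open Summit.QuantumFields.BalabanUV.Beta.GAN24.Push3 (push₃)
open Summit.QuantumFields.BalabanUV.Beta.GAN24.RespStepSemigroup (colH_KStepUnit rowM_KStepUnit_eq)
open Summit.QuantumFields.BalabanUV.Beta.GAN24.SrecLinearPartEq (colM rowMM colM_apply rowMM_apply legDecay_colM legDecay_rowMM reslot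
  e3K_eq_neg_sum_push₃)
open Summit.QuantumFields.BalabanUV.Beta.GAN24.ThirdJetKernel (e3K)

namespace Summit.QuantumFields.BalabanUV.Beta.GAN24.RespStepBm

variable {d : ℕ}

/-! ## §1 The block-mean window on the fine bond of a leg family -/

/-- [our object] **THE Π_bm-WINDOW ON THE FINE BOND OF A LEG FAMILY**: `bmW ρ N r μ y κ u := coProjBmW ρ N (r μ y) κ u = Σ_{v ∈ cube} Σ_{κ′}
pmBm ρ N κ u κ′ (u − v) · r μ y κ′ (u − v)` (an2's window operator `coProjBmW`, the adjoint of `Πᵀ_bm`, applied at each coarse bond `(μ, y)`). -/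
def bmW (ρ : Fin (d + 1) → ℤ) (N : ℕ) (r : Fin (d + 1) → (Fin (d + 1) → ℤ) → Fin (d + 1) → (Fin (d + 1) → ℤ) → ℝ)
    (μ : Fin (d + 1)) (y : Fin (d + 1) → ℤ) (κ : Fin (d + 1)) (u : Fin (d + 1) → ℤ) : ℝ :=
  coProjBmW ρ N (r μ y) κ u

variable (ρ : Fin (d + 1) → ℤ) (N : ℕ)

/-- [folklore] `bmW`, unfolded to the window sum. -/
theorem bmW_apply (r : Fin (d + 1) → (Fin (d + 1) → ℤ) → Fin (d + 1) → (Fin (d + 1) → ℤ) → ℝ) (μ : Fin (d + 1))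
    (y : Fin (d + 1) → ℤ) (κ : Fin (d + 1)) (u : Fin (d + 1) → ℤ) :
    bmW ρ N r μ y κ u = ∑ v ∈ cube (d + 1) N, ∑ κ' : Fin (d + 1), pmBm ρ N κ u κ' (u - v) * r μ y κ' (u - v) := rfl

/-- [folklore] The window is linear: signs come out. -/
theorem bmW_neg (r : Fin (d + 1) → (Fin (d + 1) → ℤ) → Fin (d + 1) → (Fin (d + 1) → ℤ) → ℝ) : bmW ρ N (-r) = -bmW ρ N r := by
  funext μ y κ u
  simp only [bmW_apply, Pi.neg_apply, mul_neg, Finset.sum_neg_distrib]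

/-- [folklore] The window is linear: scalars come out. -/
theorem bmW_smul (c : ℝ) (r : Fin (d + 1) → (Fin (d + 1) → ℤ) → Fin (d + 1) → (Fin (d + 1) → ℤ) → ℝ) :
    bmW ρ N (c • r) = c • bmW ρ N r := by
  funext μ y κ u
  simp only [bmW_apply, Pi.smul_apply, smul_eq_mul, Finset.mul_sum]
  exact Finset.sum_congr rfl fun v _ => Finset.sum_congr rfl fun κ' _ => by ring

variable {ρ N}

/-- [folklore] **THE WINDOW KEEPS THE LOCALISATION OF A LEG FAMILY** (same rate; in-block root, `1 ≤ N`, `0 ≤ m`):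
`LegDecay r M C m ⟹ LegDecay (bmW (toSite rr) N r) M (cKb d N m · C) m` — each window point `u − v` is within `ℓ¹`-distance `(d+1)·N` of `u`
(`l1_le_of_mem_cube`), `|pmBm| ≤ 1 + 4(d+1)N` (an2's `abs_pmBm_le`), `(2N+1)^{d+1}·(d+1)` terms: `cKb d N m = cWb d N · e^{m(d+1)N}`. -/
theorem legDecay_bmW {N : ℕ} (hN : 1 ≤ N) {rr : Fin (d + 1) → ℕ} (hrr : rr ∈ box (d + 1) N)
    {r : Fin (d + 1) → (Fin (d + 1) → ℤ) → Fin (d + 1) → (Fin (d + 1) → ℤ) → ℝ} {M : ℕ} {C m : ℝ} (hr : LegDecay r M C m) (hm : 0 ≤ m) :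
    LegDecay (bmW (toSite rr) N r) M (cKb d N m * C) m := by
  intro μ y κ u
  have hC := hr.nonneg
  rw [bmW_apply]
  -- every window term is bounded by `(1 + 4(d+1)N) · C · e^{m(d+1)N} · e^{−m|u − M•y|₁}`
  have hterm : ∀ v ∈ cube (d + 1) N, ∀ κ' : Fin (d + 1),
      |pmBm (toSite rr) N κ u κ' (u - v) * r μ y κ' (u - v)|
        ≤ (1 + 4 * (((d : ℝ) + 1) * N)) * (C * Real.exp (m * (((d : ℝ) + 1) * N)) * Real.exp (-m * l1 (u - (M : ℤ) • y))) := by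
    intro v hv κ'
    rw [abs_mul]
    refine mul_le_mul (abs_pmBm_le hN hrr κ u κ' (u - v)) ?_ (abs_nonneg _) (by positivity)
    refine (hr μ y κ' (u - v)).trans ?_
    rw [mul_assoc, ← Real.exp_add]
    refine mul_le_mul_of_nonneg_left (Real.exp_le_exp.2 ?_) hC
    have t := l1_sub_triangle u (u - v) ((M : ℤ) • y)
    have hv' : l1 (u - (u - v)) ≤ ((d : ℝ) + 1) * N := by
      rw [sub_sub_cancel]
      have h := l1_le_of_mem_cube hv
      push_cast at h
      exact h
    nlinarith
  calc |∑ v ∈ cube (d + 1) N, ∑ κ' : Fin (d + 1), pmBm (toSite rr) N κ u κ' (u - v) * r μ y κ' (u - v)|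
      ≤ ∑ v ∈ cube (d + 1) N, ∑ κ' : Fin (d + 1), |pmBm (toSite rr) N κ u κ' (u - v) * r μ y κ' (u - v)| :=
        (Finset.abs_sum_le_sum_abs _ _).trans (Finset.sum_le_sum fun v _ => Finset.abs_sum_le_sum_abs _ _)
    _ ≤ ∑ v ∈ cube (d + 1) N, ∑ _κ' : Fin (d + 1),
          (1 + 4 * (((d : ℝ) + 1) * N)) * (C * Real.exp (m * (((d : ℝ) + 1) * N)) * Real.exp (-m * l1 (u - (M : ℤ) • y))) :=
        Finset.sum_le_sum fun v hv => Finset.sum_le_sum fun κ' _ => hterm v hv κ'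
    _ = cKb d N m * C * Real.exp (-m * l1 (u - (M : ℤ) • y)) := by
        rw [Finset.sum_const, Finset.sum_const, Finset.card_univ, Fintype.card_fin, card_cube]
        simp only [nsmul_eq_mul]
        unfold cKb cWb
        push_cast
        ring

/-! ## §2 The four legs of the co-dressed kernel -/

section CoDressed

variable (ρ : Fin (d + 1) → ℤ) (N : ℕ) (K : MKer (d + 1) (Fib d))

/-- [folklore] **THE `ℋ`-COLUMN LEG OF THE CO-DRESSED KERNEL IS THE WINDOWED `ℋ`-COLUMN LEG** (an2's `colH_coDressKBmAt_eq`, as leg families). -/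
theorem colH_coDressKBmAt_eq_bmW : colH (coDressKBmAt ρ N K) N = bmW ρ N (colH K N) := by
  funext μ y κ u
  rw [colH_coDressKBmAt_eq]
  rfl

/-- [folklore] **THE mf-ROW LEG OF THE CO-DRESSED KERNEL IS THE WINDOWED mf-ROW LEG**: `rowM (Πᵀ_bm K Π_bm) N = bmW ρ N (rowM K N)` — the left `Πᵀ_bm` does
not touch a multiplier row (`comp_trK_piKBm_inr`), the right `Π_bm` windows the fine field index (`sum_piKBm_col_inl` + `tsum_window′`). -/
theorem rowM_coDressKBmAt : rowM (coDressKBmAt ρ N K) N = bmW ρ N (rowM K N) := by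
  funext α x' κ x
  rw [rowM_apply, coDressKBmAt_eq, bmW_apply]
  show (∑' q, ∑ f, comp (trK (piKBm ρ N)) K ((N : ℤ) • x') q (Sum.inr α) f * piKBm ρ N q x f (Sum.inl κ)) = _
  have h : ∀ q, ∑ f, comp (trK (piKBm ρ N)) K ((N : ℤ) • x') q (Sum.inr α) f * piKBm ρ N q x f (Sum.inl κ) =
      if x - q ∈ cube (d + 1) N then ∑ κ' : Fin (d + 1), pmBm ρ N κ x κ' q * K ((N : ℤ) • x') q (Sum.inr α) (Sum.inl κ') else 0 := by
    intro q
    have e : (∑ f, comp (trK (piKBm ρ N)) K ((N : ℤ) • x') q (Sum.inr α) f * piKBm ρ N q x f (Sum.inl κ)) =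
        ∑ f, piKBm ρ N q x f (Sum.inl κ) * K ((N : ℤ) • x') q (Sum.inr α) f :=
      Finset.sum_congr rfl fun f _ => by rw [comp_trK_piKBm_inr, mul_comm]
    rw [e]
    exact sum_piKBm_col_inl ρ N q x κ (fun f => K ((N : ℤ) • x') q (Sum.inr α) f)
  simp_rw [h]
  rw [tsum_window']
  simp only [rowM_apply]

/-- [folklore] **THE mm-COLUMN LEG OF THE CO-DRESSED KERNEL IS UNDRESSED** (`Π_bm` is the identity on multiplier legs). -/
theorem colM_coDressKBmAt : colM (coDressKBmAt ρ N K) N = colM K N := by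
  funext β z' μ z
  rw [colM_apply, colM_apply, coDressKBmAt_inr_inr]

/-- [folklore] **THE mm-ROW LEG OF THE CO-DRESSED KERNEL IS UNDRESSED.** -/
theorem rowMM_coDressKBmAt : rowMM (coDressKBmAt ρ N K) N = rowMM K N := by
  funext α x' μ x
  rw [rowMM_apply, rowMM_apply, coDressKBmAt_inr_inr]

variable {ρ N K}

/-- [folklore] The four legs of the co-dressed kernel of a decaying `K` are localised leg families (in-block root, `1 ≤ N`, `0 ≤ m`): the two field-slot legs
at the windowed constant `cKb d N m · C`, the two multiplier-slot legs at `C`. -/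
theorem legDecay_coDressKBmAt_legs {N : ℕ} (hN : 1 ≤ N) {rr : Fin (d + 1) → ℕ} (hrr : rr ∈ box (d + 1) N) {K : MKer (d + 1) (Fib d)}
    {C m : ℝ} (hK : Decays K C m) (hm : 0 ≤ m) :
    LegDecay (rowM (coDressKBmAt (toSite rr) N K) N) N (cKb d N m * C) m ∧
      LegDecay (colH (coDressKBmAt (toSite rr) N K) N) N (cKb d N m * C) m ∧
      LegDecay (rowMM (coDressKBmAt (toSite rr) N K) N) N C m ∧ LegDecay (colM (coDressKBmAt (toSite rr) N K) N) N C m := by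
  refine ⟨?_, ?_, ?_, ?_⟩
  · rw [rowM_coDressKBmAt]; exact legDecay_bmW hN hrr (legDecay_rowM hK) hm
  · rw [colH_coDressKBmAt_eq_bmW]; exact legDecay_bmW hN hrr (legDecay_colH hK) hm
  · rw [rowMM_coDressKBmAt]; exact legDecay_rowMM hK
  · rw [colM_coDressKBmAt]; exact legDecay_colM hK

end CoDressed

/-! ## §3 The literal's dressed one-step response families in the adopted units -/

section Literal

variable {Lc : ℕ} [NeZero Lc]

/-- [our object] **THE Π_bm-DRESSED RESPONSE FAMILY** `respStepBm ρ Lc M N′ := bmW ρ Lc (respStep M N′)` — an2's (K1b′) response family `respStep M N′ μ z l″ w′`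
(the `M`-block-contour sums of the level-`N′` minimiser column) seen through the block-mean window on its fine bond.  Its iterates along the levels are the
`legComp`-chains (NO semigroup law is claimed for the dressed families). -/
def respStepBm (ρ : Fin (d + 1) → ℤ) (Lc M N' : ℕ) [NeZero N'] :
    Fin (d + 1) → (Fin (d + 1) → ℤ) → Fin (d + 1) → (Fin (d + 1) → ℤ) → ℝ :=
  bmW ρ Lc (respStep (d := d) M N')

/-- [folklore] `respStepBm`, by `rfl`. -/
theorem respStepBm_def (ρ : Fin (d + 1) → ℤ) (Lc M N' : ℕ) [NeZero N'] :
    respStepBm (d := d) ρ Lc M N' = bmW ρ Lc (respStep (d := d) M N') := rfl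

variable (ρ : Fin (d + 1) → ℤ)

/-- [folklore] **THE COLUMN LEG OF THE CO-DRESSED NORMALISED STEP RESOLVENT IS THE DRESSED ONE-STEP RESPONSE FAMILY**:
`colH (coDressKBmAt ρ Lc K̃_j) Lc = respStepBm ρ Lc (Lc^j) (Lc^(j+1))` (leaf-12's `colH_KStepUnit` through the window). -/
theorem colH_coDressKBmAt_KStepUnit (j : ℕ) :
    colH (coDressKBmAt ρ Lc (KStepUnit (d := d) Lc j)) Lc = respStepBm ρ Lc (Lc ^ j) (Lc ^ (j + 1)) := by
  rw [colH_coDressKBmAt_eq_bmW, colH_KStepUnit, respStepBm_def]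

/-- [folklore] **THE ROW LEG OF THE CO-DRESSED NORMALISED STEP RESOLVENT IS MINUS THE DRESSED ONE-STEP RESPONSE FAMILY**:
`rowM (coDressKBmAt ρ Lc K̃_j) Lc = −respStepBm ρ Lc (Lc^j) (Lc^(j+1))` (`ℋ♭ = −ℋᵀ`: leaf-12's `rowM_KStepUnit_eq` through the window). -/
theorem rowM_coDressKBmAt_KStepUnit (j : ℕ) :
    rowM (coDressKBmAt ρ Lc (KStepUnit (d := d) Lc j)) Lc = -respStepBm ρ Lc (Lc ^ j) (Lc ^ (j + 1)) := by
  rw [rowM_coDressKBmAt, rowM_KStepUnit_eq, bmW_neg, respStepBm_def]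

/-- [folklore] The multiplier-slot legs of the co-dressed normalised step resolvent are those of `K̃_j` itself. -/
theorem colM_rowMM_coDressKBmAt_KStepUnit (j : ℕ) :
    colM (coDressKBmAt ρ Lc (KStepUnit (d := d) Lc j)) Lc = colM (KStepUnit (d := d) Lc j) Lc ∧
      rowMM (coDressKBmAt ρ Lc (KStepUnit (d := d) Lc j)) Lc = rowMM (KStepUnit (d := d) Lc j) Lc :=
  ⟨colM_coDressKBmAt ρ Lc _, rowMM_coDressKBmAt ρ Lc _⟩

variable {ρ}

/-- [folklore] **LOCALISATION OF THE DRESSED RESPONSE FAMILY FROM THE K-SLOT'S DECAY**: `Decays K̃_j C m` (`0 ≤ m`), in-block root ⟹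
`LegDecay (respStepBm (toSite rr) Lc (Lc^j) (Lc^(j+1))) Lc (cKb d Lc m · C) m` — the levelwise hypothesis of leaf-01's `Push3Nest.transport_push₃` ∕
leaf-17's `Push4Iter.legDecay_legChain` for the dressed table ∕ column legs (the row legs carry a sign, `LegDecay` is sign-blind). -/
theorem legDecay_respStepBm_of_decays (hLc : 1 ≤ Lc) {rr : Fin (d + 1) → ℕ} (hrr : rr ∈ box (d + 1) Lc) {j : ℕ} {C m : ℝ}
    (hK : Decays (KStepUnit (d := d) Lc j) C m) (hm : 0 ≤ m) :
    LegDecay (respStepBm (toSite rr) Lc (Lc ^ j) (Lc ^ (j + 1))) Lc (cKb d Lc m * C) m := by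
  rw [← colH_coDressKBmAt_KStepUnit]
  exact (legDecay_coDressKBmAt_legs hLc hrr hK hm).2.1

/-- [folklore] The same for the negated family (the row legs). -/
theorem legDecay_neg_respStepBm_of_decays (hLc : 1 ≤ Lc) {rr : Fin (d + 1) → ℕ} (hrr : rr ∈ box (d + 1) Lc) {j : ℕ} {C m : ℝ}
    (hK : Decays (KStepUnit (d := d) Lc j) C m) (hm : 0 ≤ m) :
    LegDecay (-respStepBm (toSite rr) Lc (Lc ^ j) (Lc ^ (j + 1))) Lc (cKb d Lc m * C) m := by
  rw [← rowM_coDressKBmAt_KStepUnit]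
  exact (legDecay_coDressKBmAt_legs hLc hrr hK hm).1

/-- [folklore] **LEVELWISE HYPOTHESES FOR THE CHAINS**: if every normalised step resolvent decays at some positive rate (the K-slot's `UniformDecays` gives
one rate for all `j`), then each of the four dressed ∕ undressed leg sequences of the literal satisfies `∀ j, ∃ C m, 0 < m ∧ LegDecay (· j) Lc C m` — the
form consumed by `Push4Iter.legDecay_legChain` and `Push3Nest.transport_push₃`. -/
theorem legDecay_literal_legs (hLc : 1 ≤ Lc) {rr : Fin (d + 1) → ℕ} (hrr : rr ∈ box (d + 1) Lc)
    (hK : ∀ j, ∃ C m : ℝ, 0 < m ∧ Decays (KStepUnit (d := d) Lc j) C m) :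
    (∀ j, ∃ C m : ℝ, 0 < m ∧ LegDecay (rowM (coDressKBmAt (toSite rr) Lc (KStepUnit (d := d) Lc j)) Lc) Lc C m) ∧
      (∀ j, ∃ C m : ℝ, 0 < m ∧ LegDecay (colH (coDressKBmAt (toSite rr) Lc (KStepUnit (d := d) Lc j)) Lc) Lc C m) ∧
      (∀ j, ∃ C m : ℝ, 0 < m ∧ LegDecay (rowMM (coDressKBmAt (toSite rr) Lc (KStepUnit (d := d) Lc j)) Lc) Lc C m) ∧
      (∀ j, ∃ C m : ℝ, 0 < m ∧ LegDecay (colM (coDressKBmAt (toSite rr) Lc (KStepUnit (d := d) Lc j)) Lc) Lc C m) := by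
  refine ⟨fun j => ?_, fun j => ?_, fun j => ?_, fun j => ?_⟩ <;> obtain ⟨C, m, hm, hKj⟩ := hK j <;>
    have h := legDecay_coDressKBmAt_legs hLc hrr hKj hm.le
  · exact ⟨_, m, hm, h.1⟩
  · exact ⟨_, m, hm, h.2.1⟩
  · exact ⟨_, m, hm, h.2.2.1⟩
  · exact ⟨_, m, hm, h.2.2.2⟩

end Literal

/-! ## §4 THE DRESSED-LEG READ IDENTITY -/

/-- [folklore] **THE THIRD-JET FUNCTIONAL THROUGH THE CO-DRESSED KERNEL IS A SUM OF FOUR THREE-LEG PUSHES THROUGH THE DRESSED LEGS OF `K`.**  For a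
kernel decaying at a positive rate, a local stencil family, an in-block root and `1 ≤ N`:
`e3K (coDressKBmAt ρ N K) N S κ′ u′ = −(push₃ (bmW ρ N (rowM K N)) (bmW ρ N (colH K N)) (bmW ρ N (colH K N)) (reslot inl inl S)`
`+ push₃ (bmW ρ N (rowM K N)) (colM K N) (bmW ρ N (colH K N)) (reslot inl inr S) + push₃ (rowMM K N) (bmW ρ N (colH K N)) (bmW ρ N (colH K N)) (reslot inr inl S)`
`+ push₃ (rowMM K N) (colM K N) (bmW ρ N (colH K N)) (reslot inr inr S)) κ′ u′`
(leaf-01's `SrecLinearPartEq.e3K_eq_neg_sum_push₃` at the co-dressed kernel — which decays, an2's `decays_coDressKBmAt` — with its four legs rewritten by §2). -/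
theorem e3K_coDressKBmAt_eq_neg_sum_push₃ {N : ℕ} (hN : 1 ≤ N) {rr : Fin (d + 1) → ℕ} (hrr : rr ∈ box (d + 1) N)
    {K : MKer (d + 1) (Fib d)} {C m : ℝ} (hK : Decays K C m) (hm : 0 < m)
    {S : Fin (d + 1) → (Fin (d + 1) → ℤ) → MKer (d + 1) (Fib d)} {Cs δ : ℝ} (hS : LocStencil S Cs δ) (hδ : 0 < δ)
    (κ' : Fin (d + 1)) (u' : Fin (d + 1) → ℤ) :
    e3K (coDressKBmAt (toSite rr) N K) N S κ' u'
      = -(push₃ (bmW (toSite rr) N (rowM K N)) (bmW (toSite rr) N (colH K N)) (bmW (toSite rr) N (colH K N)) (reslot Sum.inl Sum.inl S) κ' u'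
          + push₃ (bmW (toSite rr) N (rowM K N)) (colM K N) (bmW (toSite rr) N (colH K N)) (reslot Sum.inl Sum.inr S) κ' u'
          + push₃ (rowMM K N) (bmW (toSite rr) N (colH K N)) (bmW (toSite rr) N (colH K N)) (reslot Sum.inr Sum.inl S) κ' u'
          + push₃ (rowMM K N) (colM K N) (bmW (toSite rr) N (colH K N)) (reslot Sum.inr Sum.inr S) κ' u') := by
  obtain ⟨δ', C', hδ', -, hG⟩ := decays_coDressKBmAt hN hrr ⟨m, C, hm, hK.nonneg (Sum.inl 0), hK⟩
  rw [e3K_eq_neg_sum_push₃ hG hδ' N hS hδ κ' u', rowM_coDressKBmAt, colH_coDressKBmAt_eq_bmW, colM_coDressKBmAt, rowMM_coDressKBmAt]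

/-- [folklore] **THE SAME AT THE LITERAL'S KERNEL IN UNITS** `K̃_j = KStepUnit Lc j`, dressing window `Lc`: the dressed legs are `∓respStepBm ρ Lc (Lc^j) (Lc^(j+1))`
(row ∕ table-and-column), the multiplier-slot legs `rowMM K̃_j Lc` ∕ `colM K̃_j Lc` undressed. -/
theorem e3K_coDressKBmAt_KStepUnit {Lc : ℕ} [NeZero Lc] {rr : Fin (d + 1) → ℕ} (hrr : rr ∈ box (d + 1) Lc) {j : ℕ} {C m : ℝ}
    (hK : Decays (KStepUnit (d := d) Lc j) C m) (hm : 0 < m)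
    {S : Fin (d + 1) → (Fin (d + 1) → ℤ) → MKer (d + 1) (Fib d)} {Cs δ : ℝ} (hS : LocStencil S Cs δ) (hδ : 0 < δ)
    (κ' : Fin (d + 1)) (u' : Fin (d + 1) → ℤ) :
    e3K (coDressKBmAt (toSite rr) Lc (KStepUnit (d := d) Lc j)) Lc S κ' u'
      = -(push₃ (-respStepBm (toSite rr) Lc (Lc ^ j) (Lc ^ (j + 1))) (respStepBm (toSite rr) Lc (Lc ^ j) (Lc ^ (j + 1)))
              (respStepBm (toSite rr) Lc (Lc ^ j) (Lc ^ (j + 1))) (reslot Sum.inl Sum.inl S) κ' u'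
          + push₃ (-respStepBm (toSite rr) Lc (Lc ^ j) (Lc ^ (j + 1))) (colM (KStepUnit (d := d) Lc j) Lc)
              (respStepBm (toSite rr) Lc (Lc ^ j) (Lc ^ (j + 1))) (reslot Sum.inl Sum.inr S) κ' u'
          + push₃ (rowMM (KStepUnit (d := d) Lc j) Lc) (respStepBm (toSite rr) Lc (Lc ^ j) (Lc ^ (j + 1)))
              (respStepBm (toSite rr) Lc (Lc ^ j) (Lc ^ (j + 1))) (reslot Sum.inr Sum.inl S) κ' u'
          + push₃ (rowMM (KStepUnit (d := d) Lc j) Lc) (colM (KStepUnit (d := d) Lc j) Lc)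
              (respStepBm (toSite rr) Lc (Lc ^ j) (Lc ^ (j + 1))) (reslot Sum.inr Sum.inr S) κ' u') := by
  have hLc : 1 ≤ Lc := Nat.one_le_iff_ne_zero.2 (NeZero.ne Lc)
  rw [e3K_coDressKBmAt_eq_neg_sum_push₃ hLc hrr hK hm hS hδ κ' u', colH_KStepUnit, rowM_KStepUnit_eq, bmW_neg, ← respStepBm_def]

end Summit.QuantumFields.BalabanUV.Beta.GAN24.RespStepBm

end
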